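import Mathlib
import HarnessLib
import Summits.HubbardSuperconductivity.HubbardSuperconductivity.Theorems.KLProgrammeKLRegimeEngineTowerRemeasureLevUniform

/-!
# Route `KLProgramme` — crux K3 ENGINE (stmt-HubbardSuperconductivity-20437 `KLRegimeEngineV17F2`), stub (b) v2, THE LEVELS PACKAGE (ℓ):
# instantiation (I2), THE RE-BASED RE-MEASUREMENT — the input `𝒱_{dk}` of block `k ≥ 2` decomposed from the BASE `𝒱_d` (cure (A″) of located-risk #8
# «(ℓ)-BLOCK0-LOGM»; KL STATUS 2026-08-28 l.9469/(R273)(E)/l.9649; cell gate-hubbard-kl, seat p4 g19)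

…TowerMeasuredSubadditive / …TowerRemeasureLev[Uniform] re-measure `𝒱_{dk} = 𝒱_0 + Σ_{k′<k} Δ_{k′}` with the UV summand `𝒱_0` read at the family `F_0`
(`klAnisoLegKernelNormAt … klE0 0`).  The located item «(ℓ)-BLOCK0-LOGM» (k3c2-p3 g13) showed that the block-`0` chain this feeds is not `M`-uniform, and cure
(A″) starts the tower at the BASE `𝒱_d = klTowerInput … d 1`, read at `F_{d−1}` by one grid step (p3 `…CutoffKernelNormsWtAtFamily`, k3c2-p3 `…TowerLevBaseFromPlain`
/ `…TowerLevBaseLaw`).  This file is the base twin of the linearity + jump rows: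

* §1 `klTowerInput_eq_one_add_sum` — `𝒱_{dk} = 𝒱_d + Σ_{1 ≤ k′ < k} Δ_{k′}`; `klLevNormOf_klTowerInput_le_base`, `klTowerMeasLev_le_of_summand_bounds_base`
  (the measured levelled size of the input of block `k ≥ 1` against bounds of the re-measured BASE and of the re-measured increments `Δ_{k′}`, `1 ≤ k′ < k`).
* §2 `klLevNormOf_base_remeasure_le_klEng_uniform` — THE BASE `𝒱_d` RE-MEASURED at a finer family `F_{J′}`, `d ≤ J′` (jump from `F_{d−1}`; m-uniform
  constants; the instance `k := d − 1`, `T := 𝒱_d` of `klLevNormOf_jump_le_klEng_uniform`, momentum conservation by `klEffectiveAction_momentumConserving`).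
* §3 `klTowerMeasLev_le_base_add_sum_bornLev_klEng_uniform` — the summed row for `k ≥ 2`:
  `klTowerMeasLev … d k (m+1) F ≤ C₁C₂^m·(2^{(dk−1)−(d−1)})^{m−F}·N_b + Σ_{1≤k′<k} C₁C₂^m·(2^{dk−1−dk′})^{m−F}·klTowerBornLev … d k′ (m+1) F`, with `N_b` ANY bound
  of the levelled norms of the base at `F_{d−1}` and level `F` (k3c2-p3's `klLevNormOf_le_of_wtPinned` supplies it from p3's grid step).
Everything is proved; no definitions; nothing about the model is asserted; nothing asserts (ℓ), any stub, K3 or superconductivity.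
References: BGM 2006 §2.8 (2.76), (2.82)–(2.84), (2.88)–(2.90) [cite: BenfattoGiulianiMastropietro2006].
-/

noncomputable section

namespace Summit.HubbardSuperconductivity.HubbardSuperconductivity.Theorems.EngineV8

set_option linter.dupNamespace false -- summit = problem name (single-conjunct summit), D-0017

open Classical
open Real Finset Literature.MathematicalPhysics.QuantumLattice Literature.Probability.LatticeModels GrassmannAlgebra
open Literature.MathematicalPhysics.QuantumLattice.FermiRG
open Summit.HubbardSuperconductivity.HubbardSuperconductivity.Theorems.KLRegimeSplit
open Summit.HubbardSuperconductivity.HubbardSuperconductivity.Theorems.KLProgrammeLegKernels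
open Summit.HubbardSuperconductivity.HubbardSuperconductivity.Theorems.DispersionFlow
open Summit.HubbardSuperconductivity.HubbardSuperconductivity.Theorems.KLRegimeWick
open Summit.HubbardSuperconductivity.HubbardSuperconductivity.Theorems.TorusFourierL2

variable {L M : ℕ} [NeZero L] [NeZero M]

/-! ## §1 The input of block `k ≥ 1` decomposed from the base `𝒱_d` -/

omit [NeZero M] in
/-- **`𝒱_{dk} = 𝒱_d + Σ_{1 ≤ k′ < k} Δ_{k′}`** for `k ≥ 1`. -/
theorem klTowerInput_eq_one_add_sum (β U μ : ℝ) (K : TrigPolyC4v) (d : ℕ) {k : ℕ} (hk : 1 ≤ k) :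
    klTowerInput L M β U μ K d k = klTowerInput L M β U μ K d 1 + ∑ k' ∈ Ico 1 k, klTowerIncr L M β U μ K d k' := by
  induction k, hk using Nat.le_induction with
  | base => simp
  | succ k hk ih => rw [klTowerInput_succ, ih, sum_Ico_succ_top hk, add_assoc]

omit [NeZero M] in
/-- **Pointwise form, levelled, re-based**: the levelled norm of `𝒱_{dk}` at `F_{dk−1}` is at most that of the base `𝒱_d` plus those of `Δ_{k′}`, `1 ≤ k′ < k`. -/
theorem klLevNormOf_klTowerInput_le_base {β : ℝ} (hβ : 0 ≤ β) (U μ : ℝ) (K : TrigPolyC4v) (d : ℕ) {k : ℕ} (hk : 1 ≤ k) (m : ℕ)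
    (Ωe : Fin m → Option (SectorLeg (sectorCount (d * k - 1)))) :
    klLevNormOf L M β μ K (d * k - 1) m (klTowerInput L M β U μ K d k) Ωe ≤
      klLevNormOf L M β μ K (d * k - 1) m (klTowerInput L M β U μ K d 1) Ωe +
        ∑ k' ∈ Ico 1 k, klLevNormOf L M β μ K (d * k - 1) m (klTowerIncr L M β U μ K d k') Ωe := by
  rw [klTowerInput_eq_one_add_sum β U μ K d hk]
  exact (klLevNormOf_add_le hβ μ K _ m _ _ Ωe).trans (by gcongr; exact klLevNormOf_sum_le hβ μ K _ m _ _ Ωe)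

omit [NeZero M] in
/-- **`μ k ≤` re-measured BASE bound `+ Σ_{1≤k′<k}` re-measured increment bounds** (levelled track, level-count `F`, `k ≥ 1`). -/
theorem klTowerMeasLev_le_of_summand_bounds_base {β : ℝ} (hβ : 0 ≤ β) (U μ : ℝ) (K : TrigPolyC4v) (d : ℕ) {k : ℕ} (hk : 1 ≤ k) (m F : ℕ)
    {V₀ : ℝ} {W : ℕ → ℝ} (hV0 : 0 ≤ V₀) (hW0 : ∀ k' ∈ Ico 1 k, 0 ≤ W k')
    (hV : ∀ Ωe : Fin m → Option (SectorLeg (sectorCount (d * k - 1))), levelCount Ωe = F →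
      klLevNormOf L M β μ K (d * k - 1) m (klTowerInput L M β U μ K d 1) Ωe ≤ V₀)
    (hW : ∀ k' ∈ Ico 1 k, ∀ Ωe : Fin m → Option (SectorLeg (sectorCount (d * k - 1))), levelCount Ωe = F →
      klLevNormOf L M β μ K (d * k - 1) m (klTowerIncr L M β U μ K d k') Ωe ≤ W k') :
    klTowerMeasLev L M β U μ K d k m F ≤ V₀ + ∑ k' ∈ Ico 1 k, W k' := by
  have hRHS : 0 ≤ V₀ + ∑ k' ∈ Ico 1 k, W k' := add_nonneg hV0 (sum_nonneg fun k' hk' => hW0 k' hk')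
  unfold klTowerMeasLev
  rcases isEmpty_or_nonempty {Ωe : Fin m → Option (SectorLeg (sectorCount (d * k - 1))) // levelCount Ωe = F} with h | h
  · rw [Real.iSup_of_isEmpty]; exact hRHS
  · exact ciSup_le fun Ωe => (klLevNormOf_klTowerInput_le_base hβ U μ K d hk m Ωe.1).trans
      (add_le_add (hV Ωe.1 Ωe.2) (sum_le_sum fun k' hk' => hW k' hk' Ωe.1 Ωe.2))

/-! ## §2 The base `𝒱_d` re-measured at a finer family (jump from `F_{d−1}`), m-uniform constants -/

omit [NeZero L] [NeZero M] in
/-- **THE BASE `𝒱_d = klTowerInput … d 1` RE-MEASURED AT `F_{J′}`, `d ≤ J′ ≤ nScales β + 1`, m-UNIFORM** (base twin of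
`klLevNormOf_scaleZero_remeasure_le_klEng_uniform`): at every prescription `Ωe`, `klLevNormOf … J′ (m+1) 𝒱_d Ωe ≤ C₁C₂^m·(2^{J′−(d−1)})^{m − levelCount Ωe}·N_b`
whenever the levelled norms of `𝒱_d` at `F_{d−1}` of the same level are `≤ N_b`. [cite: BenfattoGiulianiMastropietro2006, §2.8 (2.82)-(2.84), (2.88)-(2.90)] -/
theorem klLevNormOf_base_remeasure_le_klEng_uniform :
    ∃ C₁ C₂ : ℝ, 0 < C₁ ∧ 0 < C₂ ∧ ∀ R : RenConsts, R.WF2 → ∃ c₃' : ℝ, 0 < c₃' ∧ ∃ U₀' : ℝ, 0 < U₀' ∧ ∀ m : ℕ,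
      ∀ (P : SplitConsts) (c : ℝ), P.WF → 0 < c → c ≤ klEngC₃6 P R → c ≤ c₃' →
      ∀ μ ∈ klWindowC, ∀ U : ℝ, 0 < U → U ≤ klEngU₀9 P R c → U ≤ U₀' → ∀ β : ℝ, klBetaMin ≤ β → β ≤ Real.exp (c / U ^ 2) →
      ∀ K : TrigPolyC4v, FrameOK R U (nScales β) μ K → ∀ (L M : ℕ) [NeZero L] [NeZero M],
      klEngL₃ β U ≤ L → klEngM₃ β U L ≤ M → ∀ d J' : ℕ, 1 ≤ d → d ≤ J' → J' ≤ nScales β + 1 →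
      ∀ (Ωe : Fin (m + 1) → Option (SectorLeg (sectorCount J'))) (Nb : ℝ), 0 ≤ Nb →
        (∀ Ωe' : Fin (m + 1) → Option (SectorLeg (sectorCount (d - 1))), levelCount Ωe' = levelCount Ωe →
          klLevNormOf L M β μ K (d - 1) (m + 1) (klTowerInput L M β U μ K d 1) Ωe' ≤ Nb) →
        klLevNormOf L M β μ K J' (m + 1) (klTowerInput L M β U μ K d 1) Ωe ≤
          C₁ * C₂ ^ m * ((2 : ℝ) ^ (J' - (d - 1))) ^ (m - levelCount Ωe) * Nb := by
  obtain ⟨C₁, C₂, hC₁, hC₂, h⟩ := klLevNormOf_jump_le_klEng_uniform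
  refine ⟨C₁, C₂, hC₁, hC₂, fun R hR2 => ?_⟩
  obtain ⟨c₃, hc₃, U₀, hU₀, h'⟩ := h R hR2
  refine ⟨c₃, hc₃, U₀, hU₀, ?_⟩
  intro m P c hP hc hc6 hc₃' μ hμ U hU hU9 hU₀' β hβmin hβc K hK L M _ _ hL3 hM3 d J' hd hdJ hJN Ωe Nb hN0 hN
  exact h' m P c hP hc hc6 hc₃' μ hμ U hU hU9 hU₀' β hβmin hβc K hK L M hL3 hM3 (d - 1) J' (by omega) hJN
    (klTowerInput L M β U μ K d 1) (fun m' X hX => by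
      unfold klTowerInput; exact klEffectiveAction_momentumConserving β U μ K klE0 (d * 1) m' X hX) Ωe Nb hN0 hN

/-! ## §3 The summed re-based `hμ` row in absolute units, ONE m-uniform constant -/

omit [NeZero L] [NeZero M] in
/-- **THE RE-BASED LEVELLED `hμ` ROW IN ABSOLUTE UNITS, m-UNIFORM** (base twin of `klTowerMeasLev_le_uv_add_sum_bornLev_klEng_lastLeg_uniform`): `C₁, C₂` and
the thresholds fixed before the degree; for every `m`, `d ≥ 2`, `k ≥ 2`, `dk − 1 ≤ nScales β + 1`, level count `F` and BASE bound `N_b` (of the levelled norms of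
`𝒱_d` at `F_{d−1}`, level `F`),
`klTowerMeasLev … d k (m+1) F ≤ C₁C₂^m·(2^{(dk−1)−(d−1)})^{m−F}·N_b + Σ_{1≤k′<k} C₁C₂^m·(2^{dk−1−dk′})^{m−F}·klTowerBornLev … d k′ (m+1) F`.
[cite: BenfattoGiulianiMastropietro2006, §2.8 (2.76), (2.82)-(2.84), (2.93)-(2.98)] -/
theorem klTowerMeasLev_le_base_add_sum_bornLev_klEng_uniform :
    ∃ C₁ C₂ : ℝ, 0 < C₁ ∧ 0 < C₂ ∧ ∀ R : RenConsts, R.WF2 → ∃ c₃' : ℝ, 0 < c₃' ∧ ∃ U₀' : ℝ, 0 < U₀' ∧ ∀ m : ℕ,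
      ∀ (P : SplitConsts) (c : ℝ), P.WF → 0 < c → c ≤ klEngC₃6 P R → c ≤ c₃' →
      ∀ μ ∈ klWindowC, ∀ U : ℝ, 0 < U → U ≤ klEngU₀9 P R c → U ≤ U₀' → ∀ β : ℝ, klBetaMin ≤ β → β ≤ Real.exp (c / U ^ 2) →
      ∀ K : TrigPolyC4v, FrameOK R U (nScales β) μ K → ∀ (L M : ℕ) [NeZero L] [NeZero M],
      klEngL₃ β U ≤ L → klEngM₃ β U L ≤ M → ∀ d k : ℕ, 2 ≤ d → 2 ≤ k → d * k - 1 ≤ nScales β + 1 →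
      ∀ F : ℕ, ∀ Nb : ℝ, 0 ≤ Nb →
        (∀ Ωe' : Fin (m + 1) → Option (SectorLeg (sectorCount (d - 1))), levelCount Ωe' = F →
          klLevNormOf L M β μ K (d - 1) (m + 1) (klTowerInput L M β U μ K d 1) Ωe' ≤ Nb) →
        klTowerMeasLev L M β U μ K d k (m + 1) F ≤
          C₁ * C₂ ^ m * ((2 : ℝ) ^ (d * k - 1 - (d - 1))) ^ (m - F) * Nb +
            ∑ k' ∈ Ico 1 k, C₁ * C₂ ^ m * ((2 : ℝ) ^ (d * k - 1 - d * k')) ^ (m - F) * klTowerBornLev L M β U μ K d k' (m + 1) F := by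
  obtain ⟨C₁, C₂, hC₁, hC₂, hbase⟩ := klLevNormOf_base_remeasure_le_klEng_uniform
  obtain ⟨C₁', C₂', hC₁', hC₂', hrel⟩ := klLevNormOf_klTowerIncr_remeasure_le_klEng_uniform
  refine ⟨max C₁ C₁', max C₂ C₂', by positivity, by positivity, fun R hR2 => ?_⟩
  obtain ⟨c₁', hc₁', U₁', hU₁', hbase'⟩ := hbase R hR2
  obtain ⟨c₃', hc₃', U₃', hU₃', hrel'⟩ := hrel R hR2
  refine ⟨min c₁' c₃', by positivity, min U₁' U₃', by positivity, ?_⟩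
  intro m P c hP hc hc6 hcmin μ hμ U hU hU9 hUmin β hβmin hβc K hK L M _ _ hL3 hM3 d k hd hk2 hkN F Nb hN0 hN
  have hβ : 0 < β := KLRegimeSplit.pos_of_klBetaMin_le hβmin
  obtain ⟨hc₁, hc₃⟩ : c ≤ c₁' ∧ c ≤ c₃' := le_min_iff.1 hcmin
  obtain ⟨hU₁, hU₃⟩ : U ≤ U₁' ∧ U ≤ U₃' := le_min_iff.1 hUmin
  have hdJ : d ≤ d * k - 1 := by have : d * 2 ≤ d * k := Nat.mul_le_mul_left d hk2; omega
  have hmax : C₁ * C₂ ^ m ≤ max C₁ C₁' * (max C₂ C₂') ^ m :=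
    mul_le_mul (le_max_left _ _) (pow_le_pow_left₀ hC₂.le (le_max_left _ _) m) (by positivity) (by positivity)
  have hmax' : C₁' * C₂' ^ m ≤ max C₁ C₁' * (max C₂ C₂') ^ m :=
    mul_le_mul (le_max_right _ _) (pow_le_pow_left₀ hC₂'.le (le_max_right _ _) m) (by positivity) (by positivity)
  refine klTowerMeasLev_le_of_summand_bounds_base (L := L) (M := M) hβ.le U μ K d (by omega : 1 ≤ k) (m + 1) F
    (W := fun k' => max C₁ C₁' * (max C₂ C₂') ^ m * ((2 : ℝ) ^ (d * k - 1 - d * k')) ^ (m - F) * klTowerBornLev L M β U μ K d k' (m + 1) F)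
    (by positivity) (fun k' _ => mul_nonneg (by positivity) (klTowerBornLev_nonneg hβ.le U μ K d k' (m + 1) F)) ?_ ?_
  · intro Ωe hlev
    have h := hbase' m P c hP hc hc6 hc₁ μ hμ U hU hU9 hU₁ β hβmin hβc K hK L M hL3 hM3 d (d * k - 1) (by omega) hdJ hkN Ωe Nb hN0
      (fun Ωe' hlev' => hN Ωe' (hlev'.trans hlev))
    rw [hlev] at h
    exact h.trans (mul_le_mul_of_nonneg_right (mul_le_mul_of_nonneg_right hmax (by positivity)) hN0)
  · intro k' hk' Ωe hlev
    have hk'k : k' < k := (mem_Ico.1 hk').2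
    have h := hrel' m P c hP hc hc6 hc₃ μ hμ U hU hU9 hU₃ β hβmin hβc K hK L M hL3 hM3 d k k' hd hk'k hkN Ωe
    rw [hlev] at h
    exact h.trans (mul_le_mul_of_nonneg_right (mul_le_mul_of_nonneg_right hmax' (by positivity))
      (klTowerBornLev_nonneg hβ.le U μ K d k' (m + 1) F))

end Summit.HubbardSuperconductivity.HubbardSuperconductivity.Theorems.EngineV8

end
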